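import Mathlib.Tactic.Linarith
import Mathlib.Tactic.NormNum
import Mathlib.Tactic.Ring
import HarnessLib

/-!
# The (0,1) cell of the ι-window, XXXIII (companion C): the product ground `B₁ × B₂`, XX — THE CORNER IV, ADDENDUM 1: LEMMA D_A (the trace
# of the global sub-line-bundle on `S`) and the dichotomy of the first regime of (Q-RES) (report [XXXIII] `H2-ZERO-ONE-33.md` §13): arithmetic shadows

Family `hodge`, b2b cell `hweil` (helper of item stmt-HodgeConjecture-2524). Report
`run/shared/lean/b2b/hodge-weil/b2b-hweil-pv1-g45/H2-ZERO-ONE-33.md` ([XXXIII]) §13 (ADDENDUM 1). Context: first regime of (Q-RES) for an RB-22 row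
`(n′, 4, m′, μ′)`: global saturated `𝓐 = N₃ ⊠ λ₃ ⊂ 𝓠` (`(n₃, d₃)`, `d₃ ≥ n′`), canonical `A = α₁ ⊠ α₂ ⊂ 𝓠|_S` (`(a₁, a₂)`, window `2n′−3 ≤ a₁ ≤ 2n′+1`,
`a₂ ≥ n′`); LEMMA D_A: `𝓐|_S ⊂ A` with cokernel on an effective divisor `D_A` of bidegree `(a₁ − 2n₃, a₂ − d₃)` and `W ∩ S = D_A ∪ P′`. Branch (I)
`D_A = 0`: `(a₁, a₂) = (2n₃, d₃)`, so `n₃ ∈ {n′−1, n′}`, `e = a₁ + 3 − 2n′ ∈ {1, 3}` (shapes (R-PIN₁)/(R-PIN₃) only), `|P′| = W·S` identically, and for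
type 1 `χ(𝒪_W) = 52 + 116d₃` resp. `10 + 170d₃`. The theorems below are that integer bookkeeping; none claims geometry. HONEST FRAMING: census work
inside the ladder's H2 test ((0,1) cell) on the SPECIAL fourfold `X₀`; nothing here is a rung; no case of the Hodge conjecture is proved; no
statement of [Markman 2025] / [Perry 2026] / [EdGFS 2025] is used.
-/

-- mandated namespace `Summit.HodgeConjecture.HodgeConjecture.…` (Problem = Summit) trips `linter.dupNamespace`; the lakefile disables it
-- tree-wide (weak option), restated here so stand-alone elaboration is warning-free too.
set_option linter.dupNamespace false

namespace Summit.HodgeConjecture.HodgeConjecture.WeilTypeLadder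

section ProductGroundTwentyAddOne

/-- **[XXXIII] 13.2 (I) (branch `D_A = 0`: only the odd shapes, and only two values of `n₃`).** If `a₁ = 2n₃` lies in the window
`2n′ − 3 ≤ a₁ ≤ 2n′ + 1` then `n₃ = n′ − 1` or `n₃ = n′`, and `e = a₁ + 3 − 2n′` is `1` or `3` respectively — the shapes (R-PIN₁), (R-PIN₃) of THEOREM
AJ-RIB; the even shapes (R-PIN₀), (R-PIN₂), (R-PIN₄) (`e ∈ {0, 2, 4}`, `a₁` odd) force `D_A ≠ 0`. [`omega`] -/
theorem pg20b_branch_one_shapes :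
    (∀ n' n₃ : ℤ, 2 * n' - 3 ≤ 2 * n₃ → 2 * n₃ ≤ 2 * n' + 1 → (n₃ = n' - 1 ∧ 2 * n₃ + 3 - 2 * n' = 1) ∨ (n₃ = n' ∧ 2 * n₃ + 3 - 2 * n' = 3)) ∧
    (∀ n' a₁ e : ℤ, e = a₁ + 3 - 2 * n' → (e = 0 ∨ e = 2 ∨ e = 4) → a₁ % 2 = 1) := by
  refine ⟨fun n' n₃ h1 h2 => by omega, fun n' a₁ e he hc => by omega⟩

/-- **[XXXIII] 13.2 (I) (consistency: in branch `D_A = 0` the colength `|P′|` equals `W·S`).** With `(a₁, a₂) = (2n₃, d₃)`: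
`|P′| = 2μ′ + 2(a₁ − n′)(a₂ − 2) − 4n′` and `W·S = 2(μ′ − n₃(4 − d₃) − (n′ − n₃)d₃)` coincide identically — as they must, since then `W ∩ S = P′` is a
proper intersection of the Cohen–Macaulay curve `W` with the Cartier divisor `S`. [`ring`] -/
theorem pg20b_colength_equals_WS :
    ∀ μ' n' n₃ d₃ : ℤ,
      2 * μ' + 2 * (2 * n₃ - n') * (d₃ - 2) - 4 * n' = 2 * (μ' - n₃ * (4 - d₃) - (n' - n₃) * d₃) := by
  intro μ' n' n₃ d₃
  ring

/-- **[XXXIII] 13.2 (I) (type 1: the Euler characteristic of the degeneracy curve in branch `D_A = 0`).** For `(n′, m′, μ′) = (10, 70, 62)`: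
`n₃ = 9`: `W·f′ = 70 − 2·9·1 = 52`, `W·S = 52 + 16d₃`, `deg ω_W = −104 − 232d₃`, `χ(𝒪_W) = 52 + 116d₃ ≥ 1212` (`d₃ ≥ 10`); `n₃ = 10`: `W·f′ = 70`,
`W·S = 44 + 20d₃`, `deg ω_W = −20 − 340d₃`, `χ(𝒪_W) = 10 + 170d₃ ≥ 1710`; and with SIGN-CUT (`d₃ = a₂ ≤ n′ + 4 = 14` in shape (R-PIN₃), i.e. `n₃ = 10`)
`χ(𝒪_W) ≤ 2390` there. [`ring` / `omega`] -/
theorem pg20b_type1_branch_one :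
    (∀ d₃ : ℤ, 70 - 2 * 9 * (10 - 9) = 52 ∧ 2 * (62 - 9 * (4 - d₃) - (10 - 9) * d₃) = 52 + 16 * d₃ ∧
      (6 - 2 * d₃) * (70 - 2 * 9 * (10 - 9)) + 2 * (10 - 2 * 9) * (62 - 9 * (4 - d₃) - (10 - 9) * d₃) = -104 - 232 * d₃) ∧
    (∀ d₃ : ℤ, 70 - 2 * 10 * (10 - 10) = 70 ∧ 2 * (62 - 10 * (4 - d₃) - (10 - 10) * d₃) = 44 + 20 * d₃ ∧
      (6 - 2 * d₃) * (70 - 2 * 10 * (10 - 10)) + 2 * (10 - 2 * 10) * (62 - 10 * (4 - d₃) - (10 - 10) * d₃) = -20 - 340 * d₃) ∧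
    (∀ d₃ : ℤ, 10 ≤ d₃ → 1212 ≤ 52 + 116 * d₃ ∧ 1710 ≤ 10 + 170 * d₃) ∧
    (∀ d₃ : ℤ, 10 ≤ d₃ → d₃ ≤ 14 → 10 + 170 * d₃ ≤ 2390) := by
  refine ⟨fun d₃ => ⟨by norm_num, by ring, by ring⟩, fun d₃ => ⟨by norm_num, by ring, by ring⟩, fun d₃ h => ⟨by omega, by omega⟩,
    fun d₃ h1 h2 => by omega⟩

/-- **[XXXIII] 13.2 (I)/(II) (the sign of `ω_W` on components, and the cycle inequalities of branch (II)).** (i) In branch (I) the coefficients of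
`ω_W ≅ 𝒪_H((n′ − 2n₃)θ₁ + (6 − 2d₃)f′)|_W` are BOTH negative (`n₃ ∈ {n′−1, n′}`, `n′ ≥ 10`, `d₃ ≥ n′`), so `ω_W` has negative degree on every component
(`(Γ·θ₁, Γ·f′) ≥ (0,0)`, not both zero), whereas a component of multiplicity one would give degree `≥ 2`: every component of `W` is multiple. (ii) In branch
(II), `[W] − [D_A]` effective gives `a₁ − 2n₃ ≤ W·f′ = m′ − 2n₃n₄` and `2(a₂ − d₃) ≤ W·S`. [`omega` / `nlinarith`] -/
theorem pg20b_omega_signs :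
    (∀ n' n₃ d₃ : ℤ, 10 ≤ n' → (n₃ = n' - 1 ∨ n₃ = n') → n' ≤ d₃ → n' - 2 * n₃ < 0 ∧ 6 - 2 * d₃ < 0) ∧
    (∀ p q t f : ℤ, p < 0 → q < 0 → 0 ≤ t → 0 ≤ f → 0 < t + f → p * t + q * f < 0) ∧
    (∀ p q t f : ℤ, p * t + q * f < 0 → ¬ (2 ≤ p * t + q * f)) := by
  refine ⟨fun n' n₃ d₃ h1 h2 h3 => ⟨by omega, by omega⟩, fun p q t f hp hq ht hf hpos => by nlinarith, fun p q t f h => by omega⟩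

end ProductGroundTwentyAddOne

end Summit.HodgeConjecture.HodgeConjecture.WeilTypeLadder
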